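import Mathlib
import Summits.Ventures.HodgeRepro2.CyclotomicSevenSubfields

/-!
# T5DegreeOneCounterexample — «residue degree one» is not «absolute local degree one»

Kernel witness (seat p5, cell pub-hodge-repro2, Tier 5) for the counterexample recorded in
`route/T5-N0-p5.md` (D6) and `route/LEAN-ANNEX-p5.md` §6 («not formalised», item 4): the
datum's prime `𝔭` of the cubic field `F` must have ABSOLUTE local degree one,
`[F_𝔭 : ℚ_p] = e·f = 1`, and not merely residue degree `f = 1` — because residue degree one
does not force `p ∤ D_F`.  The example is `F = ℚ(ζ₇)⁺`, `p = 7`: `e = 3`, `f = 1`, `7 ∣ D_F`.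

Section 1 proves the general statement behind it, for any odd prime `p`, any cyclotomic field
`K = ℚ(ζ_p)` and any intermediate field `F` with `[K : F] = 2` (so `[F : ℚ] = (p − 1)/2`):
for every prime `Q` of `𝓞 F` above `p`,
* `inertiaDeg_eq_one` : `f(Q ∣ p) = 1`,
* `two_mul_ramificationIdx` : `2 · e(Q ∣ p) = p − 1`, i.e. `e(Q ∣ p) = [F : ℚ]` (`p` is totally
  ramified in `F`), and
* `dvd_discr` : `p ∣ discr F` as soon as `4 < p` (so that `e(Q ∣ p) ≥ 2`).

The inputs are Mathlib's cyclotomic ramification theory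
(`IsCyclotomicExtension.Rat.inertiaDeg_eq_of_prime`, `…ramificationIdx_eq_of_prime`:
`f = 1`, `e = p − 1` in `ℚ(ζ_p)`), the tower formulas `Ideal.inertiaDeg_tower` /
`Ideal.ramificationIdx_tower`, the bound `Ideal.ramificationIdx_le_finrank` on both floors of the
tower `ℚ ⊆ F ⊆ K`, and Dedekind's discriminant criterion in the form
`NumberField.not_dvd_discr_iff_forall_liesOver`.

Honest scope: nothing here is about completions (the identification `[F_𝔭 : ℚ_p] = e·f` is a
statement about `F_𝔭`, not formalised), Chebotarev, or the characters of `Γ_𝔭`.  The POSITIVE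
direction of (D6) — «`e·f = 1` ⇒ `p ∤ D_F`» — is p7's `T5UnramifiedOfGalois` (p391682) and is
not repeated here.
-/

namespace Summit.Ventures.HodgeRepro2.T5DegreeOneCounterexample

open NumberField Ideal Module

section General

variable (p : ℕ) [hp : Fact p.Prime]
variable {K : Type*} [Field K] [NumberField K] [IsCyclotomicExtension {p} ℚ K]
variable (F : IntermediateField ℚ K)

/-- The rational prime `p` as an ideal of `ℤ`. -/
local notation3 "𝒑" => (span {(p : ℤ)} : Ideal ℤ)

/-- `[K : ℚ] = p − 1` for `K = ℚ(ζ_p)` (Mathlib: `IsCyclotomicExtension.finrank` with the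
irreducibility of the cyclotomic polynomial over `ℚ`). -/
theorem finrank_rat_eq : finrank ℚ K = p - 1 := by
  rw [IsCyclotomicExtension.finrank K (Polynomial.cyclotomic.irreducible_rat hp.out.pos),
    Nat.totient_prime hp.out]

/-- The degree count in the tower `ℚ ⊆ F ⊆ K`: `[F : ℚ] · [K : F] = p − 1`. -/
theorem finrank_mul_finrank_eq : finrank ℚ F * finrank F K = p - 1 := by
  rw [Module.finrank_mul_finrank ℚ F K, finrank_rat_eq p]

/-- If `[K : F] = 2` then `2 · [F : ℚ] = p − 1`. -/
theorem two_mul_finrank_eq (hF : finrank F K = 2) : 2 * finrank ℚ F = p - 1 := by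
  have := finrank_mul_finrank_eq p F
  rw [hF] at this
  omega

variable {F}

omit [IsCyclotomicExtension {p} ℚ K] in
/-- A prime `Q` of `𝓞 F` lying over `p` is non-zero. -/
theorem ne_bot_of_liesOver (Q : Ideal (𝓞 F)) [Q.LiesOver 𝒑] : Q ≠ ⊥ :=
  Ideal.ne_bot_of_liesOver_of_ne_bot (Ideal.span_singleton_eq_bot.not.mpr
    (Int.natCast_ne_zero.mpr hp.out.ne_zero)) Q

omit [IsCyclotomicExtension {p} ℚ K] in
/-- A prime `Q` of `𝓞 F` lying over `p` is maximal. -/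
theorem isMaximal_of_liesOver (Q : Ideal (𝓞 F)) [hQ : Q.IsPrime] [Q.LiesOver 𝒑] :
    Q.IsMaximal :=
  hQ.isMaximal (ne_bot_of_liesOver p Q)

/-- The residue degree of a prime `Q` of `𝓞 F` above `p` is `1`: a prime `P` of `𝓞 K` above `Q`
has `f(P ∣ p) = 1` (Mathlib, `ℚ(ζ_p)`), and `f(P ∣ p) = f(Q ∣ p) · f(P ∣ Q)`. -/
theorem inertiaDeg_eq_one (Q : Ideal (𝓞 F)) [Q.IsPrime] [Q.LiesOver 𝒑] :
    Q.inertiaDeg ℤ = 1 := by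
  haveI := isMaximal_of_liesOver p Q
  obtain ⟨P, hPmax, hPQ⟩ := Ideal.exists_maximal_ideal_liesOver_of_isIntegral (S := 𝓞 K) Q
  haveI : P.IsPrime := hPmax.isPrime
  haveI : P.LiesOver 𝒑 := Ideal.LiesOver.trans P Q 𝒑
  have h1 : P.inertiaDeg ℤ = 1 := IsCyclotomicExtension.Rat.inertiaDeg_eq_of_prime p K P
  rw [Ideal.inertiaDeg_tower Q P] at h1
  exact Nat.eq_one_of_mul_eq_one_right h1

/-- The ramification index of a prime `Q` of `𝓞 F` above `p`, when `[K : F] = 2`: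
`2 · e(Q ∣ p) = p − 1`, i.e. `e(Q ∣ p) = [F : ℚ]` — `p` is totally ramified in `F`.
Proof: `e(P ∣ p) = p − 1 = e(Q ∣ p) · e(P ∣ Q)` with `e(P ∣ Q) ≤ [K : F] = 2` and
`e(Q ∣ p) ≤ [F : ℚ] = (p − 1)/2`. -/
theorem two_mul_ramificationIdx (hF : finrank F K = 2) (Q : Ideal (𝓞 F)) [Q.IsPrime]
    [Q.LiesOver 𝒑] : 2 * Q.ramificationIdx ℤ = p - 1 := by
  haveI hQmax := isMaximal_of_liesOver p Q
  obtain ⟨P, hPmax, hPQ⟩ := Ideal.exists_maximal_ideal_liesOver_of_isIntegral (S := 𝓞 K) Q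
  haveI : P.IsPrime := hPmax.isPrime
  haveI : P.LiesOver 𝒑 := Ideal.LiesOver.trans P Q 𝒑
  haveI : 𝒑.IsMaximal := by
    have : 𝒑.IsPrime := (Ideal.span_singleton_prime (by exact_mod_cast hp.out.ne_zero)).mpr
      (Nat.prime_iff_prime_int.mp hp.out)
    exact this.isMaximal (Ideal.span_singleton_eq_bot.not.mpr (by exact_mod_cast hp.out.ne_zero))
  -- the cyclotomic value on the top floor
  have htop : P.ramificationIdx ℤ = p - 1 := IsCyclotomicExtension.Rat.ramificationIdx_eq_of_prime p K P
  -- the tower formula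
  have htower : P.ramificationIdx ℤ = Q.ramificationIdx ℤ * P.ramificationIdx (𝓞 F) :=
    Ideal.ramificationIdx_tower Q P
  -- the two bounds
  have hPQ_le : P.ramificationIdx (𝓞 F) ≤ 2 := by
    haveI : NoZeroSMulDivisors (𝓞 F) (𝓞 K) := ⟨fun h => smul_eq_zero.mp h⟩
    have h := Ideal.ramificationIdx_le_finrank (R := 𝓞 F) (S := 𝓞 K) (p := Q) F K P
    rwa [Ideal.ramificationIdx'_eq_ramificationIdx Q P (ne_bot_of_liesOver p Q), hF] at h
  have hQ_le : Q.ramificationIdx ℤ ≤ finrank ℚ F := by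
    have h := Ideal.ramificationIdx_le_finrank (R := ℤ) (S := 𝓞 F) (p := 𝒑) ℚ F Q
    rwa [Ideal.ramificationIdx'_eq_ramificationIdx 𝒑 Q
      (Ideal.span_singleton_eq_bot.not.mpr (by exact_mod_cast hp.out.ne_zero))] at h
  have hdeg := two_mul_finrank_eq p F hF
  have hPQ_pos : 0 < P.ramificationIdx (𝓞 F) := Ideal.ramificationIdx_pos P (𝓞 F)
  rw [htower] at htop
  interval_cases hPQ : P.ramificationIdx (𝓞 F) <;> omega

/-- Dedekind's discriminant criterion applied to the totally ramified prime: if `[K : F] = 2`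
and `4 < p` (so that `e(Q ∣ p) = (p − 1)/2 ≥ 2`), then `p ∣ discr F`. -/
theorem dvd_discr (hF : finrank F K = 2) (hp4 : 4 < p) : (p : ℤ) ∣ discr F := by
  by_contra hnot
  have hprime : Prime (p : ℤ) := Nat.prime_iff_prime_int.mp hp.out
  rw [NumberField.not_dvd_discr_iff_forall_liesOver F (𝓞 F) hprime] at hnot
  haveI : 𝒑.IsMaximal := by
    have : 𝒑.IsPrime := (Ideal.span_singleton_prime (by exact_mod_cast hp.out.ne_zero)).mpr hprime
    exact this.isMaximal (Ideal.span_singleton_eq_bot.not.mpr (by exact_mod_cast hp.out.ne_zero))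
  obtain ⟨Q, hQmax, hQp⟩ := Ideal.exists_maximal_ideal_liesOver_of_isIntegral (S := 𝓞 F) 𝒑
  haveI : Q.IsPrime := hQmax.isPrime
  haveI := hnot Q hQmax hQp
  have h1 : Q.ramificationIdx ℤ = 1 := Ideal.ramificationIdx_eq_one_of_isUnramifiedAt
  have h2 := two_mul_ramificationIdx p hF Q
  omega

end General

section RealSubfield

variable (p : ℕ) [hp : Fact p.Prime]
variable (K : Type*) [Field K] [NumberField K] [IsCyclotomicExtension {p} ℚ K]

omit hp [IsCyclotomicExtension {p} ℚ K] in
/-- Every subfield of `K` contains the image of `ℚ`. -/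
theorem algebraMap_rat_mem (E : Subfield K) (x : ℚ) : algebraMap ℚ K x ∈ E := by
  rw [eq_ratCast (algebraMap ℚ K) x]
  exact SubfieldClass.ratCast_mem E x

/-- The maximal real subfield `K⁺ = ℚ(ζ_p)⁺` of `K` (Mathlib's `NumberField.maximalRealSubfield`),
as an intermediate field of `K/ℚ`. -/
local notation3 "K⁺" => (maximalRealSubfield K).toIntermediateField (algebraMap_rat_mem K _)

/-- The rational prime `p` as an ideal of `ℤ`. -/
local notation3 "𝒑" => (span {(p : ℤ)} : Ideal ℤ)

omit hp in
/-- `[K : K⁺] = 2`: `K = ℚ(ζ_p)` is a CM field (`IsCyclotomicExtension.Rat.isCMField`) and `K⁺` is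
its maximal real subfield (`IsCMField.isQuadraticExtension`). -/
theorem finrank_realSubfield_top (hp2 : 2 < p) : finrank K⁺ K = 2 := by
  haveI : IsCMField K := IsCyclotomicExtension.Rat.isCMField K ⟨p, Set.mem_singleton p, hp2⟩
  exact Algebra.IsQuadraticExtension.finrank_eq_two (maximalRealSubfield K) K

/-- `2 · [K⁺ : ℚ] = p − 1`. -/
theorem two_mul_finrank_realSubfield (hp2 : 2 < p) : 2 * finrank ℚ K⁺ = p - 1 :=
  two_mul_finrank_eq p K⁺ (finrank_realSubfield_top p K hp2)

/-- Every prime `Q` of `𝓞 K⁺` above `p` has residue degree `f(Q ∣ p) = 1`. -/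
theorem inertiaDeg_eq_one_realSubfield (Q : Ideal (𝓞 K⁺)) [Q.IsPrime] [Q.LiesOver 𝒑] :
    Q.inertiaDeg ℤ = 1 :=
  inertiaDeg_eq_one p Q

/-- Every prime `Q` of `𝓞 K⁺` above `p` has ramification index `e(Q ∣ p) = (p − 1)/2 = [K⁺ : ℚ]`:
`p` is totally ramified in `ℚ(ζ_p)⁺`. -/
theorem two_mul_ramificationIdx_realSubfield (hp2 : 2 < p) (Q : Ideal (𝓞 K⁺)) [Q.IsPrime]
    [Q.LiesOver 𝒑] : 2 * Q.ramificationIdx ℤ = p - 1 :=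
  two_mul_ramificationIdx p (finrank_realSubfield_top p K hp2) Q

/-- `p ∣ discr ℚ(ζ_p)⁺` for `p ≥ 5`. -/
theorem dvd_discr_realSubfield (hp4 : 4 < p) : (p : ℤ) ∣ discr K⁺ :=
  dvd_discr p (finrank_realSubfield_top p K (by omega)) hp4

/-- THE COUNTEREXAMPLE to the residue-degree-only reading of «`deg 𝔭 = 1`» (N0 (D6)), in one
statement: for `p ≥ 5` the field `F = ℚ(ζ_p)⁺` has a prime `Q` above `p` with residue degree
`f(Q ∣ p) = 1` — and yet `e(Q ∣ p) = (p − 1)/2 > 1` and `p ∣ D_F`.  Residue degree one does NOT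
give `p ∤ D_F`; the absolute local degree `e·f = 1` does (p7's `T5UnramifiedOfGalois`). -/
theorem exists_inertiaDeg_eq_one_and_dvd_discr (hp4 : 4 < p) :
    ∃ Q : Ideal (𝓞 K⁺), Q.IsMaximal ∧ Q.LiesOver 𝒑 ∧ Q.inertiaDeg ℤ = 1 ∧
      2 * Q.ramificationIdx ℤ = p - 1 ∧ (p : ℤ) ∣ discr K⁺ := by
  haveI : 𝒑.IsMaximal := by
    have : 𝒑.IsPrime := (Ideal.span_singleton_prime (by exact_mod_cast hp.out.ne_zero)).mpr
      (Nat.prime_iff_prime_int.mp hp.out)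
    exact this.isMaximal (Ideal.span_singleton_eq_bot.not.mpr (by exact_mod_cast hp.out.ne_zero))
  obtain ⟨Q, hQmax, hQp⟩ := Ideal.exists_maximal_ideal_liesOver_of_isIntegral (S := 𝓞 K⁺) 𝒑
  haveI : Q.IsPrime := hQmax.isPrime
  exact ⟨Q, hQmax, hQp, inertiaDeg_eq_one_realSubfield p K Q,
    two_mul_ramificationIdx_realSubfield p K (by omega) Q, dvd_discr_realSubfield p K hp4⟩

end RealSubfield

section Seven

/-!
The concrete field of N0 (D6)'s sentence: `F = ℚ(ζ₇)⁺`, `p = 7`.  `K7 := CyclotomicField 7 ℚ`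
with its `IsCyclotomicExtension {7} ℚ K7` instance for the rational algebra structure is p1's
`CyclotomicSeven` (p394053, imported read-only); `K7⁺` below is Mathlib's maximal real subfield of
`K7` as an intermediate field (p1's `CyclotomicSeven.realSubfield` is the same subfield, p394279).
-/

open Summit.Ventures.HodgeRepro2.CyclotomicSeven

/-- The ideal `(7)` of `ℤ`. -/
local notation3 "𝒑₇" => (span {(7 : ℤ)} : Ideal ℤ)

/-- `K7⁺ = ℚ(ζ₇)⁺` as an intermediate field of `K7/ℚ`. -/
local notation3 "K7⁺" => (maximalRealSubfield K7).toIntermediateField (algebraMap_rat_mem K7 _)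

/-- `[ℚ(ζ₇)⁺ : ℚ] = 3`. -/
theorem finrank_realSubfield_seven : finrank ℚ K7⁺ = 3 := by
  haveI : Fact (Nat.Prime 7) := ⟨by norm_num⟩
  have := two_mul_finrank_realSubfield 7 K7 (by norm_num)
  omega

/-- `f(Q ∣ 7) = 1` for every prime `Q` of `𝓞 ℚ(ζ₇)⁺` above `7`. -/
theorem inertiaDeg_seven_eq_one (Q : Ideal (𝓞 K7⁺)) [Q.IsPrime] [Q.LiesOver 𝒑₇] :
    Q.inertiaDeg ℤ = 1 := by
  haveI : Fact (Nat.Prime 7) := ⟨by norm_num⟩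
  exact inertiaDeg_eq_one_realSubfield 7 K7 Q

/-- `e(Q ∣ 7) = 3` for every prime `Q` of `𝓞 ℚ(ζ₇)⁺` above `7`: `7` is totally ramified. -/
theorem ramificationIdx_seven_eq_three (Q : Ideal (𝓞 K7⁺)) [Q.IsPrime] [Q.LiesOver 𝒑₇] :
    Q.ramificationIdx ℤ = 3 := by
  haveI : Fact (Nat.Prime 7) := ⟨by norm_num⟩
  have := two_mul_ramificationIdx_realSubfield 7 K7 (by norm_num) Q
  omega

/-- `7 ∣ discr ℚ(ζ₇)⁺`. -/
theorem seven_dvd_discr : (7 : ℤ) ∣ discr K7⁺ := by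
  haveI : Fact (Nat.Prime 7) := ⟨by norm_num⟩
  exact dvd_discr_realSubfield 7 K7 (by norm_num)

/-- N0 (D6)'s counterexample as one statement: `ℚ(ζ₇)⁺` has a prime `Q` above `7` with
`f(Q ∣ 7) = 1`, `e(Q ∣ 7) = 3`, and `7 ∣ discr ℚ(ζ₇)⁺` — so «residue degree one» does not imply
«`p ∤ D_F`», whereas «`[F_𝔭 : ℚ_p] = e·f = 1`» does. -/
theorem counterexample_seven :
    ∃ Q : Ideal (𝓞 K7⁺), Q.IsMaximal ∧ Q.LiesOver 𝒑₇ ∧ Q.inertiaDeg ℤ = 1 ∧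
      Q.ramificationIdx ℤ = 3 ∧ (7 : ℤ) ∣ discr K7⁺ := by
  haveI : Fact (Nat.Prime 7) := ⟨by norm_num⟩
  obtain ⟨Q, hQmax, hQp, hf, he, hd⟩ := exists_inertiaDeg_eq_one_and_dvd_discr 7 K7 (by norm_num)
  exact ⟨Q, hQmax, hQp, hf, by omega, hd⟩

end Seven

end Summit.Ventures.HodgeRepro2.T5DegreeOneCounterexample
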